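import Mathlib
import Literature.AlgebraicGeometry.Resolution.FormalInverseFunction
import Summits.ResolutionOfSingularities.ResolutionOfSingularities.Theorems.WeightedInvariantLocalWeightedDropSliceChart

/-!
# `LocalWeightedDrop`: transport of the restricted point-blow-up chart under formal coordinate changes — preparations

Route `ResolutionOfSingularities/WeightedInvariant`, engine crux `LocalWeightedDrop` (stmt-ResolutionOfSingularities-8899), chain w43
[OURS · L1 W4.3 · TOT2-LINE (res-L1-w43-lead-1 g4) piece S-E1, decorated half (res-type-056); tool (T1)].  Folklore bookkeeping for
`k⟦x₀, …, xₙ⟧` over a field `k`; nothing here is a statement of any manuscript.  No definitions.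

THE SETTING.  The count game's point blow-up (all weights `1`) at the exceptional point `c` with live slot `i` (`c_i ≠ 0`) replaces a germ `f`
by (a power of `s` times) its image under the RESTRICTED CHART `ρ_{c,i} : x_i ↦ c_i s`, `x_l ↦ s (c_l + y_l)` (`l ≠ i`; `s = X 0`, the `y_l`
renumbered by `Fin.predAbove i`), see `SliceChart.subst_restrictedChart`.  The sequel (`…RestrictedChartTransport`) proves that for a formal
coordinate change `θ` (zero constant terms, invertible linear part `L`) the germs `ρ_{c,i}^* θ^* f` and `ρ_{Lc,ĩ}^* f` differ by a formal
coordinate change of the blown-up germ (the blow-up does not depend on the coordinates).  This file supplies the three ingredients: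
* `exists_factor_chart` — for `F` with `F(0) = 0`: `F(s(c + y)) = s · (C (Σ_j F_{e_j} c_j) + Ψ)` with `Ψ(0) = 0` and linear part
  `Σ_j F_{e_j} y_j + (…)·s` (the chart image of the order-`≥ 2` part of `F` is divisible by `s²`);
* `exists_factor_restrictedChart` — the same for the restricted chart (slice the previous identity at the live slot);
* `coeff_single_mul_of_constantCoeff` — linear coefficients of `P · Q` when `P(0) = 0`, `Q(0) = 1`;
* `det_transportMatrix_ne_zero` — the linear part of the transporting coordinate change is invertible: for `L` invertible, `c_i ≠ 0`, `c̃ = L c`,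
  `c̃_ĩ ≠ 0`, the matrix `N_{l m} = L_{ĩ⁺l, i⁺m} − (c̃_{ĩ⁺l} / c̃_ĩ) L_{ĩ, i⁺m}` (`p⁺· = Fin.succAbove p`) has non-zero determinant
  (its kernel vectors, padded by `0` at the slot `i`, are multiples of `c`).
-/

set_option linter.dupNamespace false -- mandated namespace of this single-conjunct summit

namespace Summit.ResolutionOfSingularities.ResolutionOfSingularities.Theorems

open Literature.AlgebraicGeometry.Resolution

namespace RestrictedChartTransport

open MvPowerSeries

variable {k : Type} [Field k] {n : ℕ}

/-! ### Linear coefficients -/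

/-- If `p₁ + p₂ = e_m` and `p₁ ≠ 0` then `p₁ = e_m` (and `p₂ = 0`). -/
theorem eq_single_of_add_eq_single {σ : Type*} {p₁ p₂ : σ →₀ ℕ} {m : σ} (h : p₁ + p₂ = Finsupp.single m 1)
    (hp : p₁ ≠ 0) : p₁ = Finsupp.single m 1 ∧ p₂ = 0 := by
  classical
  obtain ⟨l, hl⟩ := Finsupp.ne_iff.mp hp
  have hl' : p₁ l ≠ 0 := by simpa using hl
  have hlm : l = m := by
    by_contra hne
    have := congrArg (fun q => q l) h
    simp only [Finsupp.add_apply, Finsupp.single_eq_of_ne hne] at this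
    omega
  subst hlm
  have hsum := congrArg (fun q => q l) h
  simp only [Finsupp.add_apply, Finsupp.single_eq_same] at hsum
  have h1 : p₁ l = 1 := by omega
  have hp₁ : p₁ = Finsupp.single l 1 := by
    ext l'
    by_cases hl'l : l' = l
    · subst hl'l; rw [Finsupp.single_eq_same, h1]
    · have := congrArg (fun q => q l') h
      simp only [Finsupp.add_apply, Finsupp.single_eq_of_ne hl'l] at this
      rw [Finsupp.single_eq_of_ne hl'l]
      omega
  refine ⟨hp₁, ?_⟩
  have := h
  rw [hp₁] at this
  exact add_eq_left.mp this

/-- LINEAR COEFFICIENTS OF A PRODUCT `P · Q` WITH `P(0) = 0`, `Q(0) = 1`: they are those of `P`. -/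
theorem coeff_single_mul_of_constantCoeff {σ : Type*} (P Q : MvPowerSeries σ k) (hP : constantCoeff P = 0)
    (hQ : constantCoeff Q = 1) (m : σ) :
    coeff (Finsupp.single m 1) (P * Q) = coeff (Finsupp.single m 1) P := by
  classical
  rw [coeff_mul, Finset.sum_eq_single (Finsupp.single m 1, (0 : σ →₀ ℕ))]
  · rw [coeff_zero_eq_constantCoeff_apply, hQ, mul_one]
  · rintro ⟨p₁, p₂⟩ hp hne
    rw [Finset.HasAntidiagonal.mem_antidiagonal] at hp
    by_cases hp₁ : p₁ = 0
    · simp only [hp₁, coeff_zero_eq_constantCoeff_apply, hP, zero_mul]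
    · exfalso
      obtain ⟨h₁, h₂⟩ := eq_single_of_add_eq_single hp hp₁
      exact hne (Prod.ext h₁ h₂)
  · intro h
    exact absurd (Finset.HasAntidiagonal.mem_antidiagonal.mpr (add_zero _)) h

/-- Linear coefficients of `C r * φ`. -/
theorem coeff_single_C_mul {σ : Type*} (r : k) (φ : MvPowerSeries σ k) (m : σ) :
    coeff (Finsupp.single m 1) (C r * φ) = r * coeff (Finsupp.single m 1) φ := coeff_C_mul _ _ _

/-- A multiple of `X 0` has no linear coefficient at a letter `l ≠ 0`. -/
theorem coeff_single_X_zero_mul {N : ℕ} (R : MvPowerSeries (Fin (N + 1)) k) {l : Fin (N + 1)} (hl : l ≠ 0) :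
    coeff (Finsupp.single l 1) (X 0 * R) = 0 := by
  have h : (X (0 : Fin (N + 1)) : MvPowerSeries (Fin (N + 1)) k) ∣ X 0 * R := dvd_mul_right _ _
  exact (X_dvd_iff.mp h) _ (by rw [Finsupp.single_eq_of_ne (Ne.symm hl)])

/-! ### Factoring the chart image of a series without constant term through `s` -/

/-- The order-`≥ 2` part `F − Σ_j F_{e_j} X_j` of a series with `F(0) = 0`. -/
theorem two_le_order_sub_linearPart (F : MvPowerSeries (Fin (n + 1)) k) (hF : constantCoeff F = 0) :
    (2 : ℕ∞) ≤ (F - ∑ j, coeff (Finsupp.single j 1) F • (X j : MvPowerSeries (Fin (n + 1)) k)).order := by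
  classical
  rw [FormalCoordChange.two_le_order_iff]
  refine ⟨?_, fun i => ?_⟩
  · simp [hF, map_sum, constantCoeff_X]
  · simp [map_sum, coeff_index_single_X]

/-- CHART IMAGE OF A SERIES WITHOUT CONSTANT TERM, FACTORED THROUGH `s` (point blow-up, all weights `1`, exceptional point `c`):
`F(s(c + y)) = s · (C c̃ + Ψ)` with `c̃ = Σ_j F_{e_j} c_j` (the linear part of `F` evaluated at `c`), `Ψ(0) = 0` and
`[y_j] Ψ = F_{e_j}` (the chart image of the order-`≥ 2` part of `F` is divisible by `s²`). -/
theorem exists_factor_chart (c : Fin (n + 1) → k) (F : MvPowerSeries (Fin (n + 1)) k) (hF : constantCoeff F = 0) :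
    ∃ Ψ : MvPowerSeries (Fin (n + 2)) k,
      subst (CobordantChart.chart (fun _ : Fin (n + 1) => 1) c) F =
        X 0 * (C (∑ j, coeff (Finsupp.single j 1) F * c j) + Ψ) ∧
      constantCoeff Ψ = 0 ∧ ∀ j : Fin (n + 1), coeff (Finsupp.single j.succ 1) Ψ = coeff (Finsupp.single j 1) F := by
  classical
  set q : MvPowerSeries (Fin (n + 1)) k := F - ∑ j, coeff (Finsupp.single j 1) F • (X j : MvPowerSeries (Fin (n + 1)) k)
    with hq
  have hq2 : (2 : ℕ∞) ≤ q.order := two_le_order_sub_linearPart F hF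
  have hc1 : ∀ l : Fin (n + 1), (fun _ : Fin (n + 1) => (1 : ℕ)) l = 0 → c l = 0 := fun l hl => absurd hl one_ne_zero
  have hch := CobordantChart.hasSubst_chart (fun _ : Fin (n + 1) => 1) c hc1
  -- `s² ∣ q(chart)`
  have hdvd : (X (0 : Fin (n + 2)) : MvPowerSeries (Fin (n + 2)) k) ^ 2 ∣
      subst (CobordantChart.chart (fun _ : Fin (n + 1) => 1) c) q := by
    rw [X_pow_dvd_iff]
    intro m hm
    rw [← Finsupp.cons_tail m]
    refine CobordantChart.coeff_subst_chart_eq_zero_of_lt _ c hc1 q ?_ _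
    exact lt_of_lt_of_le (by exact_mod_cast hm) hq2
  obtain ⟨R, hR⟩ := hdvd
  refine ⟨∑ j, coeff (Finsupp.single j 1) F • (X j.succ : MvPowerSeries (Fin (n + 2)) k) + X 0 * R, ?_, ?_, fun j => ?_⟩
  · have hF' : F = (∑ j, coeff (Finsupp.single j 1) F • (X j : MvPowerSeries (Fin (n + 1)) k)) + q := by
      rw [hq]; abel
    conv_lhs => rw [hF']
    rw [← coe_substAlgHom hch, map_add, map_sum]
    simp only [map_smul, substAlgHom_X, coe_substAlgHom]
    rw [hR]
    simp only [CobordantChart.chart_apply, pow_one, smul_eq_C_mul]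
    have hsum : ∑ j, C (coeff (Finsupp.single j 1) F) * (X 0 * (C (c j) + X j.succ)) =
        X 0 * ∑ j, C (coeff (Finsupp.single j 1) F * c j) +
          X 0 * ∑ j, C (coeff (Finsupp.single j 1) F) * (X j.succ : MvPowerSeries (Fin (n + 2)) k) := by
      rw [Finset.mul_sum, Finset.mul_sum, ← Finset.sum_add_distrib]
      exact Finset.sum_congr rfl fun j _ => by rw [map_mul]; ring
    rw [hsum, map_sum]
    ring
  · simp [map_sum, constantCoeff_X]
  · rw [map_add, coeff_single_X_zero_mul R (Fin.succ_ne_zero j), add_zero]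
    simp [map_sum, coeff_index_single_X]

/-- THE SAME FOR THE RESTRICTED CHART at a slot `i` (`x_i ↦ c_i s`, `x_l ↦ s (c_l + y_l)`, `y_l` renumbered by `Fin.predAbove i`):
`F(ρ_{c,i}) = s · (C c̃ + Ψ)` with `c̃ = Σ_j F_{e_j} c_j`, `Ψ(0) = 0` and, for `j ≠ i`, `[y_j] Ψ = F_{e_j}` (slice the previous identity). -/
theorem exists_factor_restrictedChart (c : Fin (n + 1) → k) (i : Fin (n + 1)) (F : MvPowerSeries (Fin (n + 1)) k)
    (hF : constantCoeff F = 0) :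
    ∃ Ψ : MvPowerSeries (Fin (n + 1)) k,
      subst (fun l : Fin (n + 1) => X 0 * (C (c l) +
        if l = i then (0 : MvPowerSeries (Fin (n + 1)) k) else X (Fin.predAbove i l.succ))) F =
        X 0 * (C (∑ j, coeff (Finsupp.single j 1) F * c j) + Ψ) ∧
      constantCoeff Ψ = 0 ∧
      ∀ j : Fin (n + 1), j ≠ i → coeff (Finsupp.single (Fin.predAbove i j.succ) 1) Ψ = coeff (Finsupp.single j 1) F := by
  classical
  obtain ⟨Ψf, hfac, hΨ0, hΨ1⟩ := exists_factor_chart c F hF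
  have hc1 : ∀ l : Fin (n + 1), (fun _ : Fin (n + 1) => (1 : ℕ)) l = 0 → c l = 0 := fun l hl => absurd hl one_ne_zero
  have hσ := CobordantChartPlaneSlice.hasSubst_slice (R := k) i
  have key := SliceChart.subst_restrictedChart (fun _ : Fin (n + 1) => 1) c hc1 F 1
    (C (∑ j, coeff (Finsupp.single j 1) F * c j) + Ψf) (by rw [pow_one]; exact hfac) i
  refine ⟨subst (fun j : Fin (n + 2) => if j = i.succ then (0 : MvPowerSeries (Fin (n + 1)) k)
      else X (Fin.predAbove i j)) Ψf, ?_, ?_, fun j hj => ?_⟩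
  · have hfam : (fun l : Fin (n + 1) => X 0 * (C (c l) +
        if l = i then (0 : MvPowerSeries (Fin (n + 1)) k) else X (Fin.predAbove i l.succ))) =
        fun l : Fin (n + 1) => X 0 ^ ((fun _ : Fin (n + 1) => (1 : ℕ)) l) * (C (c l) +
          if l = i then (0 : MvPowerSeries (Fin (n + 1)) k) else X (Fin.predAbove i l.succ)) := by
      funext l; rw [pow_one]
    rw [hfam, key, pow_one, ← coe_substAlgHom hσ, map_add, coe_substAlgHom, subst_C]
  · exact constantCoeff_subst_eq_zero hσ (fun j => by split_ifs <;> simp [constantCoeff_X]) hΨ0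
  · rw [CobordantChartPlaneSlice.coeff_subst_slice, Finsupp.mapDomain_single,
      Fin.succ_succAbove_predAbove (fun h => hj (Fin.succ_injective _ h))]
    exact hΨ1 j

/-! ### The linear part of the transporting coordinate change is invertible -/

/-- KERNEL LEMMA.  For an invertible matrix `L`, a point `c` with `c_i ≠ 0` and `c̃ = L c` with `c̃_ĩ ≠ 0`, the `n × n` matrix
`N_{l m} = L_{ĩ⁺l, i⁺m} − c̃_{ĩ⁺l} · c̃_ĩ⁻¹ · L_{ĩ, i⁺m}` (`p⁺· = Fin.succAbove p`) is invertible: a kernel vector `v`, padded by `0` at the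
slot `i` to `y`, satisfies `L y ∈ k · c̃ = k · L c`, so `y ∈ k · c`, and `y_i = 0 ≠ c_i` forces `y = 0`. -/
theorem det_transportMatrix_ne_zero (L : Matrix (Fin (n + 1)) (Fin (n + 1)) k) (hL : L.det ≠ 0)
    (c : Fin (n + 1) → k) (i : Fin (n + 1)) (hci : c i ≠ 0) (ĩ : Fin (n + 1)) (hĩ : (L.mulVec c) ĩ ≠ 0) :
    (Matrix.of fun l m : Fin n => L (ĩ.succAbove l) (i.succAbove m) -
      (L.mulVec c) (ĩ.succAbove l) * ((L.mulVec c) ĩ)⁻¹ * L ĩ (i.succAbove m)).det ≠ 0 := by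
  classical
  set ct : Fin (n + 1) → k := L.mulVec c with hct
  intro hdet
  obtain ⟨v, hv, hNv⟩ := Matrix.exists_mulVec_eq_zero_iff.mpr hdet
  -- pad `v` by `0` at the slot `i`
  set y : Fin (n + 1) → k := Fin.insertNth i (0 : k) v with hy
  have hyi : y i = 0 := by rw [hy, Fin.insertNth_apply_same]
  have hym : ∀ m, y (i.succAbove m) = v m := fun m => by rw [hy, Fin.insertNth_apply_succAbove]
  have hLy : ∀ a, (L.mulVec y) a = ∑ m, L a (i.succAbove m) * v m := by
    intro a
    simp only [Matrix.mulVec, dotProduct]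
    rw [Fin.sum_univ_succAbove _ i, hyi, mul_zero, zero_add]
    exact Finset.sum_congr rfl fun m _ => by rw [hym]
  -- `L y` is proportional to `c̃ = L c`
  set t : k := (L.mulVec y) ĩ * (ct ĩ)⁻¹ with ht
  have hprop : ∀ a, (L.mulVec y) a = t * ct a := by
    intro a
    by_cases ha : a = ĩ
    · rw [ha, ht, mul_assoc, inv_mul_cancel₀ hĩ, mul_one]
    · obtain ⟨l, rfl⟩ := Fin.exists_succAbove_eq ha
      have hl := congrFun hNv l
      simp only [Matrix.mulVec, dotProduct, Matrix.of_apply, Pi.zero_apply, sub_mul, Finset.sum_sub_distrib] at hl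
      rw [sub_eq_zero] at hl
      rw [hLy, hl, ht, hLy ĩ, Finset.sum_mul, Finset.sum_mul]
      exact Finset.sum_congr rfl fun m _ => by ring
  -- hence `y = t • c`, and `y_i = 0` forces `t = 0`
  have hzero : L.mulVec (y - t • c) = 0 := by
    funext a
    rw [Matrix.mulVec_sub, Matrix.mulVec_smul, Pi.sub_apply, Pi.smul_apply, hprop a, smul_eq_mul, ← hct, sub_self,
      Pi.zero_apply]
  have hyc : y = t • c := sub_eq_zero.mp (Matrix.eq_zero_of_mulVec_eq_zero hL hzero)
  have ht0 : t = 0 := by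
    have h := congrFun hyc i
    rw [hyi, Pi.smul_apply, smul_eq_mul] at h
    exact (mul_eq_zero.mp h.symm).resolve_right hci
  apply hv
  funext m
  rw [← hym, hyc, ht0, zero_smul, Pi.zero_apply, Pi.zero_apply]

end RestrictedChartTransport

end Summit.ResolutionOfSingularities.ResolutionOfSingularities.Theorems
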